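import Summits.KontsevichZagierPeriods.KontsevichZagierPeriods.Theorems.HyperbolicBlochOffTetraSectorKernelStubAffineOrbit
import Literature.NumberTheory.Transcendental.KZRulesAssociator

/-!
# `VolumeFormOffPlane` (stmt-KontsevichZagierPeriods-14935) — line `Sketch`:
stub `stub_pointCellsWeighted` (the `ℤ`-weighted property of K-cells)

A K-CELL is an integral representation `ρ` carrying a certificate
`[ρ] − [pt, v] ∈ KZ.relations` with `v` real algebraic, where `[pt, v] = unit.constMul v _` is the
`0`-dimensional representation with domain `ℝ⁰` and constant integrand `v`. The class of K-cells
has the `ℤ`-weighted property: a weighted family `σ j` (`j < k`, weights `w j ∈ ℤ`) of K-cells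
(certificate required where `w j ≠ 0`) with `Σ w j · value (σ j) = 0` has
`Σ w j • [σ j] ∈ relations`.

Proof. Soundness of the moves gives `value (σ j) = value [pt, v j] = v j`, so `Σ w j v j = 0`.
Split `Σ w j • [σ j] = Σ w j • ([σ j] − [pt, v j]) + Σ w j • [pt, v j]`; the first sum lies in
`relations` termwise, and on the common domain `ℝ⁰` iterated integrand additivity (rule (1b))
collapses the second onto `[pt, 0]`, whose integrand vanishes.

Sources: Kontsevich–Zagier 2001, §1.2 (rule (1)), §4.1; folklore.
-/

noncomputable section

open MeasureTheory Set
open Literature.NumberTheory.Transcendental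

namespace Summit.KontsevichZagierPeriods.SymplecticScissors.LogPolytope

/-- **Stub (v7-1, the `ℤ`-weighted property of K-cells).** A weighted family of integrand-`1`
representations each carrying (where its weight is non-zero) a certificate
`[σ j] − [pt, v j] ∈ relations` with `v j` real algebraic, and with total weighted value `0`, has
weighted formal sum in `relations`: `value (σ j) = v j` (soundness), the constants `[pt, v j]` on
the common domain `ℝ⁰` combine by rule (1b) into `[pt, Σ w j v j] = [pt, 0]`, a zero integrand.
[folklore] -/
theorem stub_pointCellsWeighted : ∀ (N k : ℕ) (σ : Fin k → KZ.IntegralRep N) (w : Fin k → ℤ),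
    (∀ j, w j ≠ 0 → ∃ (v : ℝ) (hv : IsAlgebraic ℚ v),
      KZ.of (σ j) - KZ.of (KZ.IntegralRep.unit.constMul v hv) ∈ KZ.relations) →
    ∑ j, (w j : ℝ) * (σ j).value = 0 → ∑ j, w j • KZ.of (σ j) ∈ KZ.relations := by
  intro N k σ w hcert hval
  classical
  -- choose the constants `v j` (and `0` where the weight vanishes)
  have hcert' : ∀ j, ∃ (v : ℝ) (hv : IsAlgebraic ℚ v), w j ≠ 0 →
      KZ.of (σ j) - KZ.of (KZ.IntegralRep.unit.constMul v hv) ∈ KZ.relations := by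
    intro j
    by_cases h : w j = 0
    · exact ⟨0, isAlgebraic_zero, fun h' => absurd h h'⟩
    · obtain ⟨v, hv, hrel⟩ := hcert j h
      exact ⟨v, hv, fun _ => hrel⟩
  choose v hv hrel using hcert'
  -- the point cells `[pt, v j]`
  set c : Fin k → KZ.IntegralRep 0 := fun j => KZ.IntegralRep.unit.constMul (v j) (hv j) with hc
  -- soundness: `w j · value (σ j) = w j · v j`
  have hwv : ∀ j, (w j : ℝ) * (σ j).value = (w j : ℝ) * v j := by
    intro j
    by_cases h : w j = 0
    · simp [h]
    · rw [KZ.Equivalent.value_eq_holds (hrel j h)]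
      simp
  have hsumv : ∑ j, (w j : ℝ) * v j = 0 := by
    rw [← hval]
    exact Finset.sum_congr rfl fun j _ => (hwv j).symm
  -- split off the certificates
  have hsplit : ∑ j, w j • KZ.of (σ j) =
      ∑ j, w j • (KZ.of (σ j) - KZ.of (c j)) + ∑ j, w j • KZ.of (c j) := by
    rw [← Finset.sum_add_distrib]
    refine Finset.sum_congr rfl fun j _ => ?_
    rw [smul_sub, sub_add_cancel]
  have h1 : ∑ j, w j • (KZ.of (σ j) - KZ.of (c j)) ∈ KZ.relations := by
    refine sum_mem fun j _ => ?_
    by_cases h : w j = 0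
    · simp [h]
    · exact AddSubgroup.zsmul_mem _ (hrel j h) _
  -- the point cells collapse onto `[pt, 0]` on the common domain `ℝ⁰`
  set T : KZ.IntegralRep 0 := KZ.IntegralRep.unit.constMul 0 isAlgebraic_zero with hT
  have hT0 : KZ.of T ∈ KZ.relations :=
    KZ.of_mem_relations_of_eqOn_zero T fun x _ => by simp [hT]
  have hTc : KZ.of T - ∑ j, w j • KZ.of (c j) ∈ KZ.relations :=
    HyperbolicBloch.OffTetraSectorKernel.aff_orbit_of_sub_sum_zsmul_mem_relations Finset.univ c w T
      (fun j _ => rfl) fun x _ => by simp [hT, hc, hsumv]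
  have h2 : ∑ j, w j • KZ.of (c j) ∈ KZ.relations := by
    rw [← sub_sub_cancel (KZ.of T) (∑ j, w j • KZ.of (c j))]
    exact sub_mem hT0 hTc
  rw [hsplit]
  exact add_mem h1 h2

end Summit.KontsevichZagierPeriods.SymplecticScissors.LogPolytope

end
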